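import Mathlib
import HarnessLib

/-!
# The Glasser effect: the Glasser–Greene–Johnson resistive-layer dispersion relation with favourable
# average curvature, its positivity for `D_R ≤ 0`, and the tearing threshold `Δ′_c > 0`,
# `Δ′_c ∼ (τ_R/τ_A)^{1/3}` — Ham, Connor, Cowley, Hastie, Hender & Liu (2013) §1 (after GGJ 1975)

Topic `Literature/MathematicalPhysics/MHD` (namespace = path; sub-namespace `Tearing.GlasserLayer`).
Written for the venture ladder GRIDFUSION (fusion side, rung F3: the cylindrical `Δ′`-sign certificates
of models/F3-SCOPING.md R1/R3 and their wall W2 «inner-layer model dependence: the margin is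
`Δ′ − Δ′_c(model)` … certify only the model-independent conservative side `Δ′ < 0`»).  This file types
the ONE printed finite-pressure layer dispersion relation behind that sentence and PROVES the two
printed qualitative claims about it, so that «`Δ′ ≤ 0` is sufficient in the GGJ layer model too» is a
kernel fact about the printed formula rather than a remark.  Typed by gridfusion-lit-3 (g5), 2026-08-27.

## What is typed (AS PRINTED) and what is PROVED
* HamEtAl2013 §1, display (after «due to the 'Glasser effect' [Glasser75]»): the internal layer solution
  to be matched to the outer ideal solution, for a large-aspect-ratio circular plasma with a pressure
  gradient at the rational surface,
  `Δ_GGJ(γ) = 2.12·A·(γτ_A)^{5/4}·[1 − (π/4)·D_R·B·(γτ_A)^{−3/2}]`,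
  `A ≡ (nq′/q)^{−1/2}(1 + 2q²)^{1/4}(τ_R/τ_A)^{3/4}`, `B ≡ (nq′/q)(1 + 2q²)^{−1/2}(τ_R/τ_A)^{−1/2}`
  (`D_R` «the resistive interchange stability index which depends on field geometry only», «normally a
  small negative number»); the dispersion relation `Δ′ = Δ_GGJ(γ)` for the growth rate `γ`.
* PROVED: for `D_R ≤ 0` (favourable average curvature), `A > 0`, `B ≥ 0`, `τ_A > 0`, EVERY `γ > 0` has
  `Δ_GGJ(γ) > 0`; hence for `Δ′ ≤ 0` the dispersion relation has NO purely growing root — the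
  conservative side used by the ladder.  «It is this term that produces a stabilizing effect so that the
  tearing mode is stable below some critical value `Δ′ = Δ′_c > 0`»: PROVED with the SHARP threshold —
  for `D_R < 0`, `B > 0`: `Δ_GGJ(γ) ≥ Δ′_c := 2.12·A·6e⁵`, `e⁶ = (π/4)|D_R|B/5`, for all `γ > 0`, with
  equality at `γτ_A = e⁴` (so `Δ′_c = min_{γ>0} Δ_GGJ`), `Δ′_c > 0`, and NO purely growing root for
  `Δ′ < Δ′_c`.  «The effect is stronger when the resistivity is low, in fact `Δ′_c ∼ (τ_R/τ_A)^{1/3}`»: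
  PROVED as the exact scaling law `Δ′_c(S) = Δ′_c(1)·S^{1/3}` in `S = τ_R/τ_A` for the printed `A(S)`,
  `B(S)` (the exponents `3/4` of `A` and `5/6·(−1/2)` of `B^{5/6}` add to `1/3`).
No named facts; every theorem is proved.  The printed `γ` «could be a complex number»: only REAL
`γ > 0` (purely growing modes) are treated here; overstable complex roots, the derivation of the layer
solution (GGJ 1975), the inner-layer numerics (Glasser–Jardin–Tesauro) are NOT formalised.

## THREE COLUMNS
MODELLED: resistive-MHD singular layer of Glasser–Greene–Johnson (constant resistivity, large-aspect-
ratio circular geometry with favourable average curvature `D_R < 0`, asymptotic matching), purely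
growing modes; the outer-region datum `Δ′` is whatever a certificate supplies (tree:
`Tearing.IsDeltaPrime`, model-6).  CERTIFIED use: a kernel `Δ′ < 0` (or `Δ′ < Δ′_c`) certificate for a
model equilibrium excludes purely growing GGJ-layer tearing modes OF THAT MODEL; `Δ′_c` itself needs
`τ_R/τ_A`, `D_R`, `q`, `q′` at the surface (instance data).  VALIDATED: everything about devices, code
output (T7, MARS-F), and the numerical factor `2.12`'s derivation (taken as printed).

## Sources
* C. J. Ham, J. W. Connor, S. C. Cowley, R. J. Hastie, T. C. Hender, Y. Q. Liu, *Plasma Phys. Control.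
  Fusion* 55 (2013) 125015 [HamEtAl2013], §1 — the display for `Δ_GGJ(γ)`, `A`, `B` and the three
  sentences quoted above [corpus:paper:arxiv-1308.2070 p0004 L1–L12] READ 2026-08-27.
* A. H. Glasser, J. M. Greene, J. L. Johnson, Phys. Fluids 18 (1975) 875 [GlasserGreeneJohnson1975] —
  not held; cited through HamEtAl2013 («[Glasser75]») and Zheng2015 §3.2 (who defers the `D_R ≤ 0`
  case to it).

## Deliberately NOT here
`D_R` itself (typed: `Mercier.FluxForm.SurfaceData.ggjDR`, `MercierFluxForm.lean` §9); the `D_R > 0`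
resistive-interchange root sequence (ibid., `ggjRootQ`); `Δ′` (model-6's `Tearing.IsDeltaPrime`); the
pressure-flattening programme of HamEtAl2013 §2–§5; anything about a device.
-/

noncomputable section

open Real

namespace Literature.MathematicalPhysics.MHD

namespace Tearing.GlasserLayer

/-! ## §1 The printed layer response and dispersion relation -/

/-- GGJ's coefficient `A ≡ (nq′/q)^{−1/2}(1 + 2q²)^{1/4}(τ_R/τ_A)^{3/4}` AS PRINTED, as a function of the
mode/surface data `n`, `q`, `q′` (radial derivative at the rational surface) and the Lundquist-type ratio
`S = τ_R/τ_A`. [cite: HamEtAl2013, §1 (display after «Glasser effect»)] -/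
def layerA (n q q' S : ℝ) : ℝ :=
  (n * q' / q) ^ (-(1 / 2 : ℝ)) * (1 + 2 * q ^ 2) ^ (1 / 4 : ℝ) * S ^ (3 / 4 : ℝ)

/-- GGJ's coefficient `B ≡ (nq′/q)(1 + 2q²)^{−1/2}(τ_R/τ_A)^{−1/2}` AS PRINTED.
[cite: HamEtAl2013, §1 (display after «Glasser effect»)] -/
def layerB (n q q' S : ℝ) : ℝ :=
  (n * q' / q) * (1 + 2 * q ^ 2) ^ (-(1 / 2 : ℝ)) * S ^ (-(1 / 2 : ℝ))

/-- THE GGJ LAYER RESPONSE WITH FAVOURABLE CURVATURE, AS PRINTED: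
`Δ_GGJ(γ) = 2.12·A·(γτ_A)^{5/4}·[1 − (π/4)·D_R·B·(γτ_A)^{−3/2}]` (real growth rate `γ`; the inputs
`A`, `B`, `D_R`, `τ_A` as abstract reals — `layerA`, `layerB` give the printed `A`, `B`).  «The term
involving `D_R` comes from the favourable average curvature and it is proportional to the pressure
gradient.» MODELLED: see the module docstring. [cite: HamEtAl2013, §1 (display after «Glasser effect»)] -/
def deltaGGJ (A B DR τA γ : ℝ) : ℝ :=
  2.12 * A * (γ * τA) ^ (5 / 4 : ℝ) * (1 - Real.pi / 4 * DR * B * (γ * τA) ^ (-(3 / 2 : ℝ)))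

/-- The tearing DISPERSION RELATION in the GGJ layer model for a purely growing mode: `γ > 0` is a growth
rate of the surface with outer datum `Δ′` iff `Δ′ = Δ_GGJ(γ)` («The dispersion relation for the cylinder
then becomes `Δ′_m = Δ_m(ω)`»). [cite: HamEtAl2013, §1] -/
def IsGrowthRate (A B DR τA Δ' γ : ℝ) : Prop := 0 < γ ∧ Δ' = deltaGGJ A B DR τA γ

/-- The curvature weight `d = (π/4)·(−D_R)·B` (≥ 0 for favourable curvature `D_R ≤ 0`, `B ≥ 0`).
[cite: HamEtAl2013, §1] -/
def curvatureWeight (B DR : ℝ) : ℝ := Real.pi / 4 * (-DR) * B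

/-- Expanded form off `γτ_A = 0`: `Δ_GGJ(γ) = 2.12A·[(γτ_A)^{5/4} + d·(γτ_A)^{−1/4}]`, `d = (π/4)(−D_R)B`
(`x^{5/4}·x^{−3/2} = x^{−1/4}`). [cite: HamEtAl2013, §1] -/
theorem deltaGGJ_eq {A B DR τA γ : ℝ} (hx : 0 < γ * τA) :
    deltaGGJ A B DR τA γ
      = 2.12 * A * ((γ * τA) ^ (5 / 4 : ℝ) + curvatureWeight B DR * (γ * τA) ^ (-(1 / 4 : ℝ))) := by
  unfold deltaGGJ curvatureWeight
  have h : (γ * τA) ^ (5 / 4 : ℝ) * (γ * τA) ^ (-(3 / 2 : ℝ)) = (γ * τA) ^ (-(1 / 4 : ℝ)) := by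
    rw [← Real.rpow_add hx]; norm_num
  rw [← h]; ring

/-- `d ≥ 0` for `D_R ≤ 0`, `B ≥ 0`; `d > 0` for `D_R < 0`, `B > 0`. [cite: HamEtAl2013, §1] -/
theorem curvatureWeight_nonneg {B DR : ℝ} (hB : 0 ≤ B) (hDR : DR ≤ 0) : 0 ≤ curvatureWeight B DR := by
  unfold curvatureWeight
  have : 0 ≤ -DR := by linarith
  positivity

/-- idem, strict. [cite: HamEtAl2013, §1] -/
theorem curvatureWeight_pos {B DR : ℝ} (hB : 0 < B) (hDR : DR < 0) : 0 < curvatureWeight B DR := by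
  unfold curvatureWeight
  have : 0 < -DR := by linarith
  positivity

/-! ## §2 Positivity: no purely growing mode for `Δ′ ≤ 0` when `D_R ≤ 0` -/

/-- WITH FAVOURABLE AVERAGE CURVATURE THE LAYER RESPONSE IS POSITIVE AT EVERY REAL GROWTH RATE:
`D_R ≤ 0`, `A > 0`, `B ≥ 0`, `τ_A > 0`, `γ > 0 ⇒ Δ_GGJ(γ) > 0`. [cite: HamEtAl2013, §1] -/
theorem deltaGGJ_pos {A B DR τA γ : ℝ} (hA : 0 < A) (hB : 0 ≤ B) (hDR : DR ≤ 0) (hτ : 0 < τA)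
    (hγ : 0 < γ) : 0 < deltaGGJ A B DR τA γ := by
  have hx : 0 < γ * τA := mul_pos hγ hτ
  rw [deltaGGJ_eq hx]
  have h1 : 0 < (γ * τA) ^ (5 / 4 : ℝ) := Real.rpow_pos_of_pos hx _
  have h2 : 0 ≤ curvatureWeight B DR * (γ * τA) ^ (-(1 / 4 : ℝ)) :=
    mul_nonneg (curvatureWeight_nonneg hB hDR) (Real.rpow_nonneg hx.le _)
  have h3 : (0 : ℝ) < 2.12 := by norm_num
  have : 0 < (γ * τA) ^ (5 / 4 : ℝ) + curvatureWeight B DR * (γ * τA) ^ (-(1 / 4 : ℝ)) := by linarith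
  positivity

/-- THE CONSERVATIVE SIDE, AS A KERNEL FACT: in the GGJ layer model with `D_R ≤ 0`, an outer datum
`Δ′ ≤ 0` admits NO purely growing root of the dispersion relation `Δ′ = Δ_GGJ(γ)` — the ladder's
«`Δ′ < 0` stays sufficient (conservative)» for this printed layer model. [cite: HamEtAl2013, §1] -/
theorem not_isGrowthRate_of_nonpos {A B DR τA Δ' : ℝ} (hA : 0 < A) (hB : 0 ≤ B) (hDR : DR ≤ 0)
    (hτ : 0 < τA) (hΔ : Δ' ≤ 0) (γ : ℝ) : ¬ IsGrowthRate A B DR τA Δ' γ := by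
  rintro ⟨hγ, hrel⟩
  have := deltaGGJ_pos hA hB hDR hτ hγ
  linarith

/-! ## §3 The threshold `Δ′_c > 0` (sharp minimum of the layer response) -/

/-- The length scale of the Glasser threshold, `e := [(π/4)(−D_R)B/5]^{1/6}` (`e⁶ = d/5`).
[cite: HamEtAl2013, §1 («stable below some critical value Δ′ = Δ′_c > 0»)] (derived) -/
def glasserUnit (B DR : ℝ) : ℝ := (curvatureWeight B DR / 5) ^ (1 / 6 : ℝ)

/-- THE GLASSER THRESHOLD `Δ′_c := 2.12·A·6e⁵`, `e⁶ = (π/4)(−D_R)B/5` — PROVED below to be the minimum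
of `Δ_GGJ` over real `γ > 0` (so «the tearing mode is stable below some critical value
`Δ′ = Δ′_c > 0`» holds with this `Δ′_c` in the layer model). [cite: HamEtAl2013, §1] (value derived) -/
def glasserThreshold (A B DR : ℝ) : ℝ := 2.12 * A * (6 * glasserUnit B DR ^ 5)

/-- `e > 0` and `e⁶ = d/5` for `D_R < 0`, `B > 0`. [cite: HamEtAl2013, §1] (derived) -/
theorem glasserUnit_pos_and_pow_six {B DR : ℝ} (hB : 0 < B) (hDR : DR < 0) :
    0 < glasserUnit B DR ∧ glasserUnit B DR ^ 6 = curvatureWeight B DR / 5 := by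
  have hd : 0 < curvatureWeight B DR / 5 := div_pos (curvatureWeight_pos hB hDR) (by norm_num)
  unfold glasserUnit
  refine ⟨Real.rpow_pos_of_pos hd _, ?_⟩
  rw [show (1 / 6 : ℝ) = ((6 : ℕ) : ℝ)⁻¹ by norm_num]
  exact Real.rpow_inv_natCast_pow hd.le (by norm_num)

/-- `Δ′_c > 0` (`A > 0`, `B > 0`, `D_R < 0`). [cite: HamEtAl2013, §1] -/
theorem glasserThreshold_pos {A B DR : ℝ} (hA : 0 < A) (hB : 0 < B) (hDR : DR < 0) :
    0 < glasserThreshold A B DR := by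
  unfold glasserThreshold
  have := (glasserUnit_pos_and_pow_six hB hDR).1
  have h3 : (0 : ℝ) < 2.12 := by norm_num
  positivity

/-- The elementary inequality behind the minimum: `z⁵ + 5/z ≥ 6` for `z > 0`, with
`z⁶ − 6z + 5 = (z − 1)²(z⁴ + 2z³ + 3z² + 4z + 5)`. [folklore] -/
private theorem six_le_pow_five_add {z : ℝ} (hz : 0 < z) : 6 ≤ z ^ 5 + 5 / z := by
  have hfac : z ^ 5 + 5 / z - 6 = (z - 1) ^ 2 * (z ^ 4 + 2 * z ^ 3 + 3 * z ^ 2 + 4 * z + 5) / z := by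
    field_simp
    ring
  have h0 : 0 ≤ z ^ 5 + 5 / z - 6 := by rw [hfac]; positivity
  linarith

/-- Fourth-root bookkeeping: for `x > 0`, with `y = x^{1/4}`: `y > 0`, `x^{5/4} = y⁵`, `x^{−1/4} = y⁻¹`,
`y⁴ = x`. [folklore] -/
private theorem quarter_root {x : ℝ} (hx : 0 < x) :
    0 < x ^ (1 / 4 : ℝ) ∧ x ^ (5 / 4 : ℝ) = (x ^ (1 / 4 : ℝ)) ^ 5
      ∧ x ^ (-(1 / 4 : ℝ)) = (x ^ (1 / 4 : ℝ))⁻¹ ∧ (x ^ (1 / 4 : ℝ)) ^ 4 = x := by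
  refine ⟨Real.rpow_pos_of_pos hx _, ?_, ?_, ?_⟩
  · rw [← Real.rpow_mul_natCast hx.le]; norm_num
  · rw [Real.rpow_neg hx.le]
  · rw [← Real.rpow_mul_natCast hx.le]; norm_num

/-- THE SHARP LOWER BOUND: for `D_R < 0`, `B > 0`, `A > 0`, `τ_A > 0` and every `γ > 0`,
`Δ′_c ≤ Δ_GGJ(γ)` (weighted AM–GM: `y⁵ + d/y ≥ 6e⁵` with `y = (γτ_A)^{1/4}`, `d = 5e⁶`).
[cite: HamEtAl2013, §1 («stable below some critical value Δ′ = Δ′_c > 0»)] -/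
theorem glasserThreshold_le_deltaGGJ {A B DR τA γ : ℝ} (hA : 0 < A) (hB : 0 < B) (hDR : DR < 0)
    (hτ : 0 < τA) (hγ : 0 < γ) : glasserThreshold A B DR ≤ deltaGGJ A B DR τA γ := by
  have hx : 0 < γ * τA := mul_pos hγ hτ
  obtain ⟨hy, h54, h14, hy4⟩ := quarter_root hx
  set y := (γ * τA) ^ (1 / 4 : ℝ) with hydef
  obtain ⟨he, he6⟩ := glasserUnit_pos_and_pow_six hB hDR
  set e := glasserUnit B DR with hedef
  rw [deltaGGJ_eq hx, h54, h14]
  unfold glasserThreshold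
  rw [← hedef]
  have hd : curvatureWeight B DR = 5 * e ^ 6 := by linarith [he6]
  rw [hd]
  -- reduce to `6 ≤ z⁵ + 5/z` with `z = y/e`
  have hz : 0 < y / e := div_pos hy he
  have key := six_le_pow_five_add hz
  have hid : e ^ 5 * ((y / e) ^ 5 + 5 / (y / e)) = y ^ 5 + 5 * e ^ 6 * y⁻¹ := by
    field_simp
  have h212 : (0 : ℝ) < 2.12 * A := by positivity
  have he5 : 0 < e ^ 5 := by positivity
  have hmul := mul_le_mul_of_nonneg_left key he5.le
  have : 6 * e ^ 5 ≤ y ^ 5 + 5 * e ^ 6 * y⁻¹ := by linarith [hmul, hid]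
  exact mul_le_mul_of_nonneg_left this h212.le

/-- THE BOUND IS ATTAINED at `γ* = e⁴/τ_A` (`y = e`): `Δ_GGJ(γ*) = Δ′_c` — so `Δ′_c` is the minimum of
the layer response over real `γ > 0`. [cite: HamEtAl2013, §1] (derived) -/
theorem deltaGGJ_minimiser {A B DR τA : ℝ} (hB : 0 < B) (hDR : DR < 0) (hτ : 0 < τA) :
    deltaGGJ A B DR τA (glasserUnit B DR ^ 4 / τA) = glasserThreshold A B DR := by
  obtain ⟨he, he6⟩ := glasserUnit_pos_and_pow_six hB hDR
  set e := glasserUnit B DR with hedef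
  have hx : e ^ 4 / τA * τA = e ^ 4 := by field_simp
  have hx0 : 0 < e ^ 4 := by positivity
  have hroot : (e ^ 4) ^ (1 / 4 : ℝ) = e := by
    rw [show (1 / 4 : ℝ) = ((4 : ℕ) : ℝ)⁻¹ by norm_num]
    exact Real.pow_rpow_inv_natCast he.le (by norm_num)
  obtain ⟨_, h54, h14, _⟩ := quarter_root hx0
  rw [deltaGGJ_eq (by rw [hx]; exact hx0), hx, h54, h14, hroot]
  unfold glasserThreshold
  rw [← hedef]
  have hd : curvatureWeight B DR = 5 * e ^ 6 := by linarith [he6]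
  rw [hd]
  field_simp
  ring

/-- «THE TEARING MODE IS STABLE BELOW SOME CRITICAL VALUE `Δ′ = Δ′_c > 0`», kernel form: for
`Δ′ < Δ′_c` the dispersion relation `Δ′ = Δ_GGJ(γ)` has no real root `γ > 0` (`D_R < 0`, `A, B, τ_A > 0`).
[cite: HamEtAl2013, §1] -/
theorem not_isGrowthRate_of_lt_threshold {A B DR τA Δ' : ℝ} (hA : 0 < A) (hB : 0 < B) (hDR : DR < 0)
    (hτ : 0 < τA) (hΔ : Δ' < glasserThreshold A B DR) (γ : ℝ) : ¬ IsGrowthRate A B DR τA Δ' γ := by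
  rintro ⟨hγ, hrel⟩
  have := glasserThreshold_le_deltaGGJ hA hB hDR hτ hγ
  linarith

/-- Conversely the threshold itself IS a (marginal) root: `Δ′ = Δ′_c` has the purely growing solution
`γ* = e⁴/τ_A > 0` — the bound `Δ′ < Δ′_c` is sharp. [cite: HamEtAl2013, §1] (derived) -/
theorem isGrowthRate_threshold {A B DR τA : ℝ} (hB : 0 < B) (hDR : DR < 0) (hτ : 0 < τA) :
    IsGrowthRate A B DR τA (glasserThreshold A B DR) (glasserUnit B DR ^ 4 / τA) := by
  refine ⟨div_pos (pow_pos (glasserUnit_pos_and_pow_six hB hDR).1 4) hτ, ?_⟩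
  exact (deltaGGJ_minimiser hB hDR hτ).symm

/-! ## §4 The printed scaling `Δ′_c ∼ (τ_R/τ_A)^{1/3}` -/

/-- `A(S) = A(1)·S^{3/4}` for the printed `A`. [cite: HamEtAl2013, §1] -/
theorem layerA_scale (n q q' S : ℝ) :
    layerA n q q' S = layerA n q q' 1 * S ^ (3 / 4 : ℝ) := by
  unfold layerA
  rw [Real.one_rpow]; ring

/-- `B(S) = B(1)·S^{−1/2}` for the printed `B`. [cite: HamEtAl2013, §1] -/
theorem layerB_scale (n q q' S : ℝ) :
    layerB n q q' S = layerB n q q' 1 * S ^ (-(1 / 2 : ℝ)) := by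
  unfold layerB
  rw [Real.one_rpow]; ring

/-- The curvature weight scales like `B`: `d(S) = d(1)·S^{−1/2}`. [cite: HamEtAl2013, §1] -/
theorem curvatureWeight_scale (n q q' DR S : ℝ) :
    curvatureWeight (layerB n q q' S) DR = curvatureWeight (layerB n q q' 1) DR * S ^ (-(1 / 2 : ℝ)) := by
  unfold curvatureWeight
  rw [layerB_scale n q q' S]; ring

/-- The threshold length scales as `e(S) = e(1)·S^{−1/12}` (favourable curvature, `B(1) > 0`).
[cite: HamEtAl2013, §1] (derived) -/
theorem glasserUnit_scale (n q q' DR : ℝ) {S : ℝ} (hS : 0 < S) (hB1 : 0 < layerB n q q' 1)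
    (hDR : DR < 0) :
    glasserUnit (layerB n q q' S) DR = glasserUnit (layerB n q q' 1) DR * S ^ (-(1 / 12 : ℝ)) := by
  unfold glasserUnit
  rw [curvatureWeight_scale n q q' DR S, mul_div_right_comm,
    Real.mul_rpow (div_pos (curvatureWeight_pos hB1 hDR) (by norm_num)).le (Real.rpow_nonneg hS.le _),
    ← Real.rpow_mul hS.le]
  norm_num

/-- «`Δ′_c ∼ (τ_R/τ_A)^{1/3}`» AS AN EXACT SCALING LAW of the sharp threshold for the printed `A(S)`,
`B(S)`, `S = τ_R/τ_A`: `Δ′_c(S) = Δ′_c(1)·S^{1/3}` (the exponents: `3/4` from `A`, `5·(−1/12)` from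
`e⁵`; `3/4 − 5/12 = 1/3`).  Hypotheses: `S > 0`, `B(1) > 0` (i.e. `nq′/q > 0`), `D_R < 0`.
[cite: HamEtAl2013, §1 («Δ′_c ∼ (τ_R/τ_A)^{1/3}»)] -/
theorem glasserThreshold_scale (n q q' DR : ℝ) {S : ℝ} (hS : 0 < S) (hB1 : 0 < layerB n q q' 1)
    (hDR : DR < 0) :
    glasserThreshold (layerA n q q' S) (layerB n q q' S) DR
      = glasserThreshold (layerA n q q' 1) (layerB n q q' 1) DR * S ^ (1 / 3 : ℝ) := by
  unfold glasserThreshold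
  rw [layerA_scale n q q' S, glasserUnit_scale n q q' DR hS hB1 hDR, mul_pow,
    ← Real.rpow_mul_natCast hS.le]
  have h : S ^ (3 / 4 : ℝ) * S ^ (-(1 / 12 : ℝ) * ((5 : ℕ) : ℝ)) = S ^ (1 / 3 : ℝ) := by
    rw [← Real.rpow_add hS]; norm_num
  calc 2.12 * (layerA n q q' 1 * S ^ (3 / 4 : ℝ))
          * (6 * (glasserUnit (layerB n q q' 1) DR ^ 5 * S ^ (-(1 / 12 : ℝ) * ((5 : ℕ) : ℝ))))
        = 2.12 * layerA n q q' 1 * (6 * glasserUnit (layerB n q q' 1) DR ^ 5)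
          * (S ^ (3 / 4 : ℝ) * S ^ (-(1 / 12 : ℝ) * ((5 : ℕ) : ℝ))) := by ring
    _ = 2.12 * layerA n q q' 1 * (6 * glasserUnit (layerB n q q' 1) DR ^ 5) * S ^ (1 / 3 : ℝ) := by
          rw [h]

end Tearing.GlasserLayer

end Literature.MathematicalPhysics.MHD

end
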